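import Summits.QuantumFields.Balaban3D.Carriers.RT
import Summits.QuantumFields.Balaban3D.Carriers.Regions

/-!
# Lane `pub-balaban3d` — carrier layer p1 (`Carriers.Masses`): the MASSES of the large-field histories DEFINED (D-p1-5) — the
# integrated-out «Σ_{{Ω_j}} ∫dV_{k−1}↾_{Z_{k−1}} δ(V̄_{k−1}V^{−1}) ⋯ χ_k ζ χ_{k−1} ⋯ ζ_{Ω₁ᶜ}» of [Balaban1985UV3] (41) p. 266 as iterated
# Radon–Nikodym transports of {0,1}-valued weights, pinned into `[0,1]`; hence `Carriers.Histories.HistWeights` INHABITED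

READING (seat note D-p1-5, lead batch 6 «AGREED»).  At the passage `k → k+1` the weight of a history `h` is the {0,1}-valued function of
the field `V_k` on `T^{(k)}`: `ζ` = «large field on the plaquettes `P_k = last h`» times `χ_k` = «small field on the other plaquettes of
`Λ_k(h)`» ((7) p. 257, (40) p. 266), times the admissibility indicator; it depends on `V_k` only through the bonds of `Z_k(h) ⊇ Λ_k(h)`.
The mass is `m_{k+1}(h, V) := 𝟙[h admissible]·min 1 (max 0 (T_k[w_k(h) · m_k(proj h, ·)](V)))` with `T_k` the RN transport of `Carriers.RT` over the
averaging `Ū_k`: for a Haar-compatible local averaging the fibre `{V_k : V̄_k = V}` factorises into its `Z_k`-part and its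
`B(Λ_{k+1})`-part and the latter integrates the constant `1` against a conditional probability, so this IS print's restricted integral
`∫dV_k↾_{Z_k} δ(V̄_kV^{−1}) ζχ_k m_k` dV-a.e. (the small-field factor `χ` INSIDE `B(Λ_{k+1})` of (49) belongs to the fluctuation integral,
not to the mass — no double counting); `min 1`/`max 0` only pin the a.e.-version into `[0,1]` (ruling R-RN spirit).  The thresholds of
`ζ`/`χ` are parameters (`εL k` = g_kp(g_k) of (7)/p. 267 L36–37, `εS k` = 2L²g_{k−1}p(g_{k−1}) of (40)).  [folklore] measure-theoretic
bookkeeping; nothing of CMP 102 is asserted.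
-/

open MeasureTheory

namespace Summit.QuantumFields.Balaban3D.Carriers

open Literature.MathematicalPhysics.QuantumFieldTheory.Balaban1983to89

variable {P : Params} {G : Type} [GaugeGroup G]

section Weights

variable (M₁ : ℕ) (Rcol : ℕ → ℕ) (εL εS : ℕ → ℝ)

open Classical in
/-- THE {0,1}-WEIGHT of the passage `k → k+1` for the history `h` at the field `V_k` on `T^{(k)}`: admissible history, LARGE field
(`|V_k(∂p) − 1| ≥ εL k`) on every plaquette of `P_k = last h` (the `ζ` of (7)/(8)), SMALL field (`|V_k(∂p) − 1| < εS k`) on every other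
plaquette covered by `Λ_k(h)` (the `χ_k` of (40)). [cite: Balaban1985UV3, (40) p.266] -/
noncomputable def stepWeight (k : ℕ) (h : Hist P (k + 1)) (V : GaugeField P k G) : ℝ :=
  if Hist.Admissible M₁ Rcol (k + 1) h ∧
      (∀ p ∈ h.last, εL k ≤ dist1 (GaugeField.plaqHol V p)) ∧
      (∀ p : Plaq P k, p ∉ h.last → plaqCover p ⊆ Lam M₁ Rcol h k → dist1 (GaugeField.plaqHol V p) < εS k)
  then 1 else 0

/-- The weight is `0` or `1`. [folklore] -/
theorem stepWeight_nonneg (k : ℕ) (h : Hist P (k + 1)) (V : GaugeField P k G) : 0 ≤ stepWeight M₁ Rcol εL εS k h V := by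
  unfold stepWeight; split_ifs <;> norm_num

/-- The weight is at most `1`. [folklore] -/
theorem stepWeight_le_one (k : ℕ) (h : Hist P (k + 1)) (V : GaugeField P k G) : stepWeight M₁ Rcol εL εS k h V ≤ 1 := by
  unfold stepWeight; split_ifs <;> norm_num

/-- Inadmissible histories carry weight `0`. [folklore] -/
theorem stepWeight_of_not_admissible (k : ℕ) {h : Hist P (k + 1)} (hh : ¬ Hist.Admissible M₁ Rcol (k + 1) h)
    (V : GaugeField P k G) : stepWeight M₁ Rcol εL εS k h V = 0 := by
  unfold stepWeight; rw [if_neg (fun H => hh H.1)]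

/-- At the trivial history the step weight is `1` identically (in the standing range `k ≤ m + K`): no large-field plaquettes, and
`Λ_k(triv) = ∅` carries no small-field condition (print: Ω_{k+1} = T_η, p. 272 L32–33). [folklore] -/
theorem stepWeight_triv {k : ℕ} (hk : k ≤ P.m + P.K) (U : GaugeField P k G) :
    stepWeight M₁ Rcol εL εS k (Hist.triv P (k + 1)) U = 1 := by
  unfold stepWeight
  rw [if_pos]
  refine ⟨Hist.admissible_triv M₁ Rcol (k + 1), fun p hp => by simp at hp, fun p _ hcov => ?_⟩
  exfalso
  obtain ⟨x, hx⟩ := coarsen_surjective k hk p.src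
  have hxL : x ∈ Lam M₁ Rcol (Hist.triv P (k + 1)) k := hcov (Or.inl hx)
  unfold Lam at hxL
  rw [Omega_triv, Omega_triv] at hxL
  exact hxL.2 trivial

variable [MeasurableSpace G] [HaarData G] (av : ∀ j, Averaging P j G)

open Classical in
/-- **THE MASSES** `m_k(h, V)` of (41), recursively: `m_0 = 1`; `m_{k+1}(triv, V) = 1` (no large fields: nothing is integrated — the
(47)-term of (41), p. 272 L32–33 «Ω_{k+1} = T_η»; v1.2, seat p4's `hmt`); otherwise `m_{k+1}(h, V) = 𝟙[h admissible] · min 1 (max 0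
(T_k[w_k(h)·m_k(proj h)](V)))` with `T_k` the RN transport over `Ū_k` (see the module docstring for the reading).  The two pins choose
the VERSION of the a.e.-class print defines: the admissibility indicator (v1.1, lead batch 13 (e) / seat p2's `hW`) makes the mass of an
inadmissible history vanish POINTWISE, and the trivial history's mass is `1` POINTWISE — the RN transport of the constant weight `1` is
`1` only dV-a.e. (Haar compatibility, `Measure.rnDeriv_self`). [cite: Balaban1985UV3, (41) p.266 + (47) p.267] -/
noncomputable def massRec : (k : ℕ) → Hist P k → GaugeField P k G → ℝ
  | 0, _, _ => 1
  | k + 1, h, V => if h = Hist.triv P (k + 1) then 1 else if Hist.Admissible M₁ Rcol (k + 1) h then min 1 (max 0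
      (AveragingRT.rnTransport (av k).avg (fun U => stepWeight M₁ Rcol εL εS k h U * massRec k h.proj U) V)) else 0

open Classical in
/-- `m ≥ 0`. [folklore] -/
theorem massRec_nonneg : ∀ (k : ℕ) (h : Hist P k) (V : GaugeField P k G), 0 ≤ massRec M₁ Rcol εL εS av k h V
  | 0, _, _ => zero_le_one
  | k + 1, h, V => by
    show 0 ≤ ite _ _ _
    split_ifs
    · exact zero_le_one
    · exact le_min zero_le_one (le_max_left _ _)
    · exact le_rfl

open Classical in
/-- `m ≤ 1`. [folklore] -/
theorem massRec_le_one : ∀ (k : ℕ) (h : Hist P k) (V : GaugeField P k G), massRec M₁ Rcol εL εS av k h V ≤ 1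
  | 0, _, _ => le_rfl
  | k + 1, h, V => by
    show ite _ _ _ ≤ 1
    split_ifs
    · exact le_rfl
    · exact min_le_left _ _
    · exact zero_le_one

/-- `m_0 = 1`. [folklore] -/
theorem massRec_zero (h : Hist P 0) (V : GaugeField P 0 G) : massRec M₁ Rcol εL εS av 0 h V = 1 := rfl

open Classical in
/-- **Inadmissible histories have mass `0`, pointwise** (seat p2's `hW` of `lf_dominated_adm` / `lf_tower3_adm`, lead batch 13 (e)). [folklore] -/
theorem massRec_eq_zero_of_not_admissible : ∀ (k : ℕ) (h : Hist P k) (V : GaugeField P k G),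
    ¬ Hist.Admissible M₁ Rcol k h → massRec M₁ Rcol εL εS av k h V = 0
  | 0, _, _, hh => absurd trivial hh
  | k + 1, h, V, hh => by
    show ite _ _ _ = 0
    rw [if_neg (fun ht => hh (by rw [ht]; exact Hist.admissible_triv M₁ Rcol (k + 1))), if_neg hh]

open Classical in
open Classical in
/-- **The trivial history has mass `1`, pointwise, at every level** (seat p4's `hmt` of `lower57_le_upper55`; the (47)-term). [folklore] -/
theorem massRec_triv : ∀ (k : ℕ) (V : GaugeField P k G), massRec M₁ Rcol εL εS av k (Hist.triv P k) V = 1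
  | 0, _ => rfl
  | k + 1, V => by
    show ite _ _ _ = 1
    rw [if_pos rfl]

open Classical in
/-- The recursion step for an ADMISSIBLE, NON-TRIVIAL history; the `max 0` is a no-op (the transported integrand is non-negative, so the
RN transport is already `≥ 0`). [folklore] -/
theorem massRec_succ (k : ℕ) (h : Hist P (k + 1)) (hh : Hist.Admissible M₁ Rcol (k + 1) h) (ht : h ≠ Hist.triv P (k + 1))
    (V : GaugeField P (k + 1) G) :
    massRec M₁ Rcol εL εS av (k + 1) h V =
      min 1 (AveragingRT.rnTransport (av k).avg (fun U => stepWeight M₁ Rcol εL εS k h U * massRec M₁ Rcol εL εS av k h.proj U) V) := by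
  show ite _ _ _ = _
  rw [if_neg ht, if_pos hh, max_eq_right]
  exact AveragingRT.rnTransport_nonneg _ _
    (fun U => mul_nonneg (stepWeight_nonneg M₁ Rcol εL εS k h U) (massRec_nonneg M₁ Rcol εL εS av k _ U)) V

open Classical in
/-- **The masses are measurable in the field**, every level and history (seat p4's `hmeas`): the pins are field-independent and the RN
transport is measurable with no hypothesis on the averaging (`Carriers.measurable_rnTransport`). [folklore] -/
theorem measurable_massRec : ∀ (k : ℕ) (h : Hist P k), Measurable (massRec M₁ Rcol εL εS av k h)
  | 0, _ => measurable_const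
  | k + 1, h => by
    by_cases ht : h = Hist.triv P (k + 1)
    · have : massRec M₁ Rcol εL εS av (k + 1) h = fun _ => 1 := funext fun V => by subst ht; exact massRec_triv _ _ _ _ _ _ V
      rw [this]; exact measurable_const
    by_cases hh : Hist.Admissible M₁ Rcol (k + 1) h
    · have : massRec M₁ Rcol εL εS av (k + 1) h = fun V => min 1 (AveragingRT.rnTransport (av k).avg
          (fun U => stepWeight M₁ Rcol εL εS k h U * massRec M₁ Rcol εL εS av k h.proj U) V) :=
        funext fun V => massRec_succ M₁ Rcol εL εS av k h hh ht V
      rw [this]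
      exact measurable_const.min (measurable_rnTransport _ _)
    · have : massRec M₁ Rcol εL εS av (k + 1) h = fun _ => 0 :=
        funext fun V => massRec_eq_zero_of_not_admissible M₁ Rcol εL εS av (k + 1) h V hh
      rw [this]; exact measurable_const

/-- At the first passage EVERY history is admissible (`Ω₀ = T_η`: the large-field plaquettes `P₀` are unconstrained, (7) p. 257). [folklore] -/
theorem Hist.admissible_one (h : Hist P 1) : Hist.Admissible M₁ Rcol 1 h :=
  ⟨trivial, fun _ _ => Set.subset_univ _⟩

/-- **THE FIRST MASS** (the defining equation for (48)₀ that seat p4's drafts booked as a hypothesis, rulings R-48/R-MASS): `m_1(h, V) = min 1 (T_0[w_0(h)](V))` (`h ≠ triv`) with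
`w_0(h)` = 𝟙[large on `P₀ = last h` ∧ small elsewhere] ((7)–(8) p. 257–258) and `m_0 = 1`. [cite: Balaban1985UV3, (8) p.258 + (48) p.268] -/
theorem massRec_one (h : Hist P 1) (ht : h ≠ Hist.triv P 1) (V : GaugeField P 1 G) :
    massRec M₁ Rcol εL εS av 1 h V =
      min 1 (AveragingRT.rnTransport (av 0).avg (fun U => stepWeight M₁ Rcol εL εS 0 h U) V) := by
  rw [massRec_succ M₁ Rcol εL εS av 0 h (Hist.admissible_one M₁ Rcol h) ht]
  simp only [massRec_zero, mul_one]


/-- **`HistWeights` INHABITED by the constructed masses** (D-p1-5): the interface record of `Carriers.Histories` filled. [cite: Balaban1985UV3, (41) p.266] -/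
noncomputable def histWeights3 : HistWeights P G where
  mass := massRec M₁ Rcol εL εS av
  mass_nonneg := massRec_nonneg M₁ Rcol εL εS av
  mass_le_one := massRec_le_one M₁ Rcol εL εS av
  mass_zero := massRec_zero M₁ Rcol εL εS av

/-- **Seat p2's `hW` for the lane's masses**: `histWeights3` vanishes on inadmissible histories, pointwise, at every level. [folklore] -/
theorem histWeights3_mass_eq_zero_of_not_admissible (k : ℕ) (h : Hist P k) (V : GaugeField P k G)
    (hh : ¬ Hist.Admissible M₁ Rcol k h) : (histWeights3 M₁ Rcol εL εS av).mass k h V = 0 :=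
  massRec_eq_zero_of_not_admissible M₁ Rcol εL εS av k h V hh

end Weights

end Summit.QuantumFields.Balaban3D.Carriers
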